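import Mathlib
import HarnessLib
import Summits.HubbardSuperconductivity.HubbardSuperconductivity.Theorems.KLProgrammeKLRegimeSplitEngineV9

/-!
# Raising the freezing constant `CF` and the first-moment constant `cE4` of a geometric package `G` — the transfer toolkit for
# the ONE batched `G`-level swap of the K3 engine (`klEngGeo3 ↦ klEngGeo4 := klEngGeo3.raise (T̂_iso ^ 4) E₄`)

Cell `gate-hubbard-kl`, seat p3 g6; planner ruling (R7)(b) (STATUS 2026-08-27 04:15Z).  The scale-`0` (E5-S)₀ closer
`isoTupleL1AtS_zero_of_klEngU₀3` needs `T̂_iso ^ 4 ≤ G.CF` (`T̂_iso` a closed but non-numeric term), and (E4)₀ may need a larger `cE4`;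
the package of record has `klEngGeo3.CF = 2^52`, `klEngGeo3.cE4 = 2^10` as literals.  This file provides, for ANY `G` and any `T E : ℝ`:

* **`GeoConsts.raise G T E := { G with CF := max G.CF T, cE4 := max G.cE4 E }`** with `rfl` lemmas for every untouched field, the four
  inequalities `G.CF ≤ _`, `T ≤ _`, `G.cE4 ≤ _`, `E ≤ _`, and **`GeoConsts.raise_wf : G.WF → (G.raise T E).WF`** (`CF` enters `GeoConsts.WF`
  only as `0 ≤ CF` and as the upper bound of the two gain sums; `cE4` only as `0 ≤ cE4`);
* the majorants that do not read `CF`/`cE4` are literally unchanged (`initDevBar`, `legDressBarQ`, `gainBar`, `eremBar`, `driveBar`, `drivePBar`,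
  `klEdge`, `twoLegBar`, `bflBar`, `lipBar`, `Bcum`, `abot0`, `atop0`: `… (G.raise T E) … = … G …`), and `thermalBar` (the only `CF`-reading
  majorant of the V9 engine slot) is MONOTONE: `thermalBar G ≤ thermalBar (G.raise T E)`;
* predicate level, COVARIANT transfers `… G … → … (G.raise T E) …` for every conjunct of the engine slot `EngineBoundsAtV9S`:
  `QuarticValueUVAtS2` (an `iff`), `PairLadderStepAtV9`, `PairValueIncrementAtV6`, `QuarticValueIncrementAtS3` (through `thermalBar`),
  `EngineFirstMoments` (general `G.cE4 ≤ G'.cE4` monotonicity, `0 ≤ P.Klam`), `IsoTupleL1AtS` (general `G.CF ≤ G'.CF` monotonicity), hence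
  **`engineBoundsAtV9S_raise_of`**.

NOT covered (and not true by monotonicity): the two-leg slot `TwoLegStepV14` and the history `HistP klPredsV14`, which read `EngineBoundsAtV9S`
in HYPOTHESIS position (`histV14` inside `FrameLipschitzFnT` / `TwoLegVolumeRate`); closers of step stubs that take the history at a literal
package must be `G`-parametric (or re-keyed) to survive the swap — this file only guarantees that their `G`-reading majorants are unchanged
(`twoLegBar_raise`, `lipBar_raise`, `bflBar_raise`, `raise_phGain`, `raise_ppGain`, …).  No new constants, no named facts; everything proved.
-/

namespace Summit.HubbardSuperconductivity.HubbardSuperconductivity.Theorems.KLRegimeSplit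

noncomputable section

open Real Finset Literature.MathematicalPhysics.QuantumLattice Literature.Probability.LatticeModels
open Summit.HubbardSuperconductivity.HubbardSuperconductivity.Theorems.KLProgrammeLegKernels

/-! ## §1 The raised package -/

/-- **`G.raise T E`** — the geometric package `G` with `CF := max G.CF T` and `cE4 := max G.cE4 E`, every other field untouched. -/
def GeoConsts.raise (G : GeoConsts) (T E : ℝ) : GeoConsts :=
  { G with CF := max G.CF T, cE4 := max G.cE4 E }

namespace GeoConsts

variable (G : GeoConsts) (T E : ℝ)

/-- `(G.raise T E).CF = max G.CF T`. -/
theorem raise_CF : (G.raise T E).CF = max G.CF T := rfl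
/-- `(G.raise T E).cE4 = max G.cE4 E`. -/
theorem raise_cE4 : (G.raise T E).cE4 = max G.cE4 E := rfl
/-- untouched field `atop`. -/
theorem raise_atop : (G.raise T E).atop = G.atop := rfl
/-- untouched field `abot`. -/
theorem raise_abot : (G.raise T E).abot = G.abot := rfl
/-- untouched field `blo`. -/
theorem raise_blo : (G.raise T E).blo = G.blo := rfl
/-- untouched field `bhi`. -/
theorem raise_bhi : (G.raise T E).bhi = G.bhi := rfl
/-- untouched field `cloc`. -/
theorem raise_cloc : (G.raise T E).cloc = G.cloc := rfl
/-- untouched field `θ`. -/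
theorem raise_θ : (G.raise T E).θ = G.θ := rfl
/-- untouched field `a`. -/
theorem raise_a : (G.raise T E).a = G.a := rfl
/-- untouched field `ζ`. -/
theorem raise_ζ : (G.raise T E).ζ = G.ζ := rfl
/-- untouched field `Z`. -/
theorem raise_Z : (G.raise T E).Z = G.Z := rfl
/-- untouched field `aplus`. -/
theorem raise_aplus : (G.raise T E).aplus = G.aplus := rfl
/-- untouched field `ppGain`. -/
theorem raise_ppGain : (G.raise T E).ppGain = G.ppGain := rfl
/-- untouched field `phGain`. -/
theorem raise_phGain : (G.raise T E).phGain = G.phGain := rfl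
/-- untouched field `S`. -/
theorem raise_S : (G.raise T E).S = G.S := rfl
/-- untouched field `Bf`. -/
theorem raise_Bf : (G.raise T E).Bf = G.Bf := rfl
/-- untouched field `SL`. -/
theorem raise_SL : (G.raise T E).SL = G.SL := rfl

/-- `G.CF ≤ (G.raise T E).CF`. -/
theorem CF_le_raise_CF : G.CF ≤ (G.raise T E).CF := le_max_left _ _
/-- `T ≤ (G.raise T E).CF`. -/
theorem le_raise_CF : T ≤ (G.raise T E).CF := le_max_right _ _
/-- `G.cE4 ≤ (G.raise T E).cE4`. -/
theorem cE4_le_raise_cE4 : G.cE4 ≤ (G.raise T E).cE4 := le_max_left _ _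
/-- `E ≤ (G.raise T E).cE4`. -/
theorem le_raise_cE4 : E ≤ (G.raise T E).cE4 := le_max_right _ _

variable {G}

/-- **Raising preserves well-formedness**: `CF` enters `GeoConsts.WF` only through `0 ≤ CF` and as the upper bound of the particle–hole and
particle–particle gain sums, `cE4` only through `0 ≤ cE4`; all three survive `· ≤ max · _`. -/
theorem raise_wf (hG : G.WF) (T E : ℝ) : (G.raise T E).WF := by
  obtain ⟨h1, h2, h3, h4, h5, h6, h7, h8, h9, h10, h11, h12, h13, h14, h15, h16, h17, h18, h19, h20⟩ := hG
  refine ⟨h1, h2, h3, h4, h5, h6, h7, h8, h9, h10, h11, h12, h13, ?_, ?_, ?_, ?_, h18, h19, h20⟩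
  · exact h14.trans (le_max_left _ _)
  · exact fun ρ N hρ => (h15 ρ N hρ).trans (le_max_left _ _)
  · exact fun ρ t N hρ => (h16 ρ t N hρ).trans (le_max_left _ _)
  · exact h17.trans (le_max_left _ _)

end GeoConsts

/-! ## §2 The majorants under `raise` -/

section Bars

variable (G : GeoConsts) (T E : ℝ) (P : SplitConsts) (Q : EngConsts)

/-- `initDevBar` does not read `CF`/`cE4`. -/
theorem initDevBar_raise (U : ℝ) : initDevBar (G.raise T E) U = initDevBar G U := rfl
/-- `legDressBarQ` does not read `G` at all. -/
theorem legDressBarQ_raise (U : ℝ) (n c : ℕ) : legDressBarQ (G.raise T E) P Q U n c = legDressBarQ G P Q U n c := rfl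
/-- `gainBar` reads only the gains. -/
theorem gainBar_raise (U : ℝ) (n : ℕ) (ρpp ρd ρx : ℝ) : gainBar (G.raise T E) P U n ρpp ρd ρx = gainBar G P U n ρpp ρd ρx := rfl
/-- `eremBar` reads only `cloc`, `θ`. -/
theorem eremBar_raise (U β : ℝ) (L n : ℕ) : eremBar (G.raise T E) P Q U β L n = eremBar G P Q U β L n := rfl
/-- `driveBar` reads only `a`, `ζ`. -/
theorem driveBar_raise (U : ℝ) (χ : D4Irrep) (n : ℕ) : driveBar (G.raise T E) U χ n = driveBar G U χ n := rfl
/-- `drivePBar` reads only `aplus`, `ζ`. -/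
theorem drivePBar_raise (U : ℝ) (n : ℕ) : drivePBar (G.raise T E) P U n = drivePBar G P U n := rfl
/-- `klEdge` reads only `bhi`. -/
theorem klEdge_raise (n : ℕ) (ρ : ℝ) : klEdge (G.raise T E) n ρ = klEdge G n ρ := rfl
/-- `twoLegBar` reads only `S`. -/
theorem twoLegBar_raise (U : ℝ) (j n : ℕ) : twoLegBar (G.raise T E) Q U j n = twoLegBar G Q U j n := rfl
/-- `bflBar` reads only `Bf`, `θ`. -/
theorem bflBar_raise (U : ℝ) (n : ℕ) : bflBar (G.raise T E) Q U n = bflBar G Q U n := rfl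
/-- `lipBar` reads only `SL`. -/
theorem lipBar_raise (U : ℝ) (n : ℕ) : lipBar (G.raise T E) Q U n = lipBar G Q U n := rfl
/-- `Bcum` reads only `bhi`. -/
theorem Bcum_raise (n : ℕ) : Bcum (G.raise T E) n = Bcum G n := rfl
/-- `Ecum` reads only `cloc`, `θ`, `a`, `ζ`. -/
theorem Ecum_raise (U β : ℝ) (L : ℕ) (χ : D4Irrep) (n : ℕ) : Ecum (G.raise T E) P Q U β L χ n = Ecum G P Q U β L χ n := rfl
/-- `EcumP` reads only `cloc`, `θ`, `aplus`, `ζ`. -/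
theorem EcumP_raise (U β : ℝ) (L n : ℕ) : EcumP (G.raise T E) P Q U β L n = EcumP G P Q U β L n := rfl
/-- `abot0` reads only `abot`. -/
theorem abot0_raise (U : ℝ) (χ : D4Irrep) : abot0 (G.raise T E) U χ = abot0 G U χ := rfl
/-- `atop0` reads only `atop`. -/
theorem atop0_raise (U : ℝ) (χ : D4Irrep) : atop0 (G.raise T E) U χ = atop0 G U χ := rfl

/-- **`thermalBar` is monotone in `CF`**: for `G.CF ≤ G'.CF`, `thermalBar G ≤ thermalBar G'` (the only `CF`-reading majorant of the V9 slot). -/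
theorem thermalBar_mono {G G' : GeoConsts} (h : G.CF ≤ G'.CF) (P : SplitConsts) (U β : ℝ) (n : ℕ) :
    thermalBar G P U β n ≤ thermalBar G' P U β n := by
  unfold thermalBar
  have h1 : 0 ≤ (P.Klam * U) ^ 2 * ((4 : ℝ) ^ (nScales β - n))⁻¹ := by positivity
  nlinarith

/-- `thermalBar G ≤ thermalBar (G.raise T E)`. -/
theorem thermalBar_le_raise (U β : ℝ) (n : ℕ) : thermalBar G P U β n ≤ thermalBar (G.raise T E) P U β n :=
  thermalBar_mono (G.CF_le_raise_CF T E) P U β n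

end Bars

/-! ## §3 The engine slot under `raise` -/

section Model

variable {L M : ℕ} [NeZero L] [NeZero M] {G : GeoConsts} {P : SplitConsts} {Q : EngConsts} {β U μ : ℝ} {K : TrigPolyC4v} {n : ℕ}
variable (T E : ℝ)

/-- **(E2′-S2 UV) is unchanged by `raise`** (it reads `G` only through `initDevBar` and `legDressBarQ`). -/
theorem quarticValueUVAtS2_raise_iff :
    QuarticValueUVAtS2 L M (G.raise T E) P Q β U μ K n ↔ QuarticValueUVAtS2 L M G P Q β U μ K n := by
  simp only [QuarticValueUVAtS2, initDevBar_raise, legDressBarQ_raise]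

/-- **(E2-v9) transfers to `raise`**: the scale-`0` clause is unchanged (`initDevBar`, `legDressBarQ`); the step clause's tolerance grows only
through `thermalBar` (`bhi`, `klEdge`, `drivePBar`, `eremBar`, `legDressBarQ`, `phGain` unchanged). -/
theorem pairLadderStepAtV9_raise_of (h : PairLadderStepAtV9 L M G P Q β U μ K n) :
    PairLadderStepAtV9 L M (G.raise T E) P Q β U μ K n := by
  obtain ⟨h0, hs⟩ := h
  refine ⟨fun hn Qm k hk k' hk' => ?_, fun hn Qm hQm => ?_⟩
  · rw [initDevBar_raise, legDressBarQ_raise]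
    exact h0 hn Qm k hk k' hk'
  · obtain ⟨w, hw1, hw2, N, hN, hb⟩ := hs hn Qm hQm
    refine ⟨w, hw1, ?_, N, hN, fun k hk k' hk' => (hb k hk k' hk').trans ?_⟩
    · rw [klEdge_raise]; exact hw2
    · rw [drivePBar_raise, eremBar_raise, legDressBarQ_raise, GeoConsts.raise_phGain]
      have := thermalBar_le_raise G T E P U β n
      linarith

/-- **(E2″-v6) transfers to `raise`** (`gainBar`, `eremBar`, `legDressBarQ` unchanged, `thermalBar` monotone). -/
theorem pairValueIncrementAtV6_raise_of (h : PairValueIncrementAtV6 L M G P Q β U μ K n) :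
    PairValueIncrementAtV6 L M (G.raise T E) P Q β U μ K n := by
  intro hn Qm k hk k' hk'
  refine (h hn Qm k hk k' hk').trans ?_
  rw [gainBar_raise, eremBar_raise, legDressBarQ_raise]
  have := thermalBar_le_raise G T E P U β n
  linarith

/-- **(E2′-S3) transfers to `raise`** (`gainBar`, `eremBar`, `legDressBarQ` unchanged, `thermalBar` monotone). -/
theorem quarticValueIncrementAtS3_raise_of (h : QuarticValueIncrementAtS3 L M G P Q β U μ K n) :
    QuarticValueIncrementAtS3 L M (G.raise T E) P Q β U μ K n := by
  intro hn k₁ hk₁ k₂ hk₂ k₃ hk₃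
  refine (h hn k₁ hk₁ k₂ hk₂ k₃ hk₃).trans ?_
  rw [gainBar_raise, eremBar_raise, legDressBarQ_raise]
  have := thermalBar_le_raise G T E P U β n
  linarith

/-- **(E4) is monotone in `cE4`**: for `G.cE4 ≤ G'.cE4` and `0 ≤ P.Klam`, `EngineFirstMoments … G … → EngineFirstMoments … G' …`. -/
theorem engineFirstMoments_mono {G G' : GeoConsts} (hc : G.cE4 ≤ G'.cE4) (hK : 0 ≤ P.Klam)
    (h : EngineFirstMoments L M G P Q β U μ K n) : EngineFirstMoments L M G' P Q β U μ K n := by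
  intro Ω i k
  refine (h Ω i k).trans ?_
  have h1 : 0 ≤ P.Klam * |U| * (4 : ℝ) ^ n := by positivity
  have : (G.cE4 + Q.cE4 * |U|) * P.Klam * |U| * (4 : ℝ) ^ n = (G.cE4 + Q.cE4 * |U|) * (P.Klam * |U| * (4 : ℝ) ^ n) := by ring
  rw [this]
  have : (G'.cE4 + Q.cE4 * |U|) * P.Klam * |U| * (4 : ℝ) ^ n = (G'.cE4 + Q.cE4 * |U|) * (P.Klam * |U| * (4 : ℝ) ^ n) := by ring
  rw [this]
  exact mul_le_mul_of_nonneg_right (by linarith) h1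

/-- **(E4) transfers to `raise`** (`0 ≤ P.Klam`). -/
theorem engineFirstMoments_raise_of (hK : 0 ≤ P.Klam) (h : EngineFirstMoments L M G P Q β U μ K n) :
    EngineFirstMoments L M (G.raise T E) P Q β U μ K n :=
  engineFirstMoments_mono (G.cE4_le_raise_cE4 T E) hK h

/-- **(E5-S) is monotone in `CF`**: for `G.CF ≤ G'.CF`, `IsoTupleL1AtS … G … → IsoTupleL1AtS … G' …` (the tolerance is `CF·B + CF·(Klam U)²`
with `B ≥ 0`). -/
theorem isoTupleL1AtS_mono {G G' : GeoConsts} (hCF : G.CF ≤ G'.CF) (h : IsoTupleL1AtS L M G P β U μ K n) :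
    IsoTupleL1AtS L M G' P β U μ K n := by
  intro B hB hval m hm Ω hΩ x₁
  refine (h B hB hval m hm Ω hΩ x₁).trans ?_
  have h1 : 0 ≤ (P.Klam * U) ^ 2 := sq_nonneg _
  nlinarith

/-- **(E5-S) transfers to `raise`.** -/
theorem isoTupleL1AtS_raise_of (h : IsoTupleL1AtS L M G P β U μ K n) : IsoTupleL1AtS L M (G.raise T E) P β U μ K n :=
  isoTupleL1AtS_mono (G.CF_le_raise_CF T E) h

/-- **The whole V9 engine slot transfers to `raise`**: `EngineBoundsAtV9S … G … n → EngineBoundsAtV9S … (G.raise T E) … n` (`0 ≤ P.Klam`;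
(E0) and (E1-v4) do not read `G`). -/
theorem engineBoundsAtV9S_raise_of (hK : 0 ≤ P.Klam) (h : EngineBoundsAtV9S L M G P Q β U μ K n) :
    EngineBoundsAtV9S L M (G.raise T E) P Q β U μ K n := by
  obtain ⟨h0, h1, h2, h3, h4, h5, h6, h7⟩ := h
  exact ⟨h0, h1, pairLadderStepAtV9_raise_of T E h2, pairValueIncrementAtV6_raise_of T E h3, quarticValueIncrementAtS3_raise_of T E h4,
    (quarticValueUVAtS2_raise_iff T E).2 h5, engineFirstMoments_raise_of T E hK h6, isoTupleL1AtS_raise_of T E h7⟩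

end Model

end

end Summit.HubbardSuperconductivity.HubbardSuperconductivity.Theorems.KLRegimeSplit
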